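import Mathlib
import HarnessLib
import Summits.HubbardSuperconductivity.HubbardSuperconductivity.Theorems.KLProgrammeKLRegimeSplitSlotsV17F2
import Summits.HubbardSuperconductivity.HubbardSuperconductivity.Theorems.KLProgrammeKLRegimeSplitGlue
import Summits.HubbardSuperconductivity.HubbardSuperconductivity.Theorems.KLProgrammeKLRegimeSplitPredicatesV5

/-!
# K3 gen-8-FLOW (stmt-HubbardSuperconductivity-20437 `KLRegimeEngineV17F2`, stub (C) `stub_twoLeg_curvature`): the (C) one-call's HISTORY-KEYED families —
# flow-piece jets, reading jets, flow geometry and the flow-frame admissibility `FrameOK R U m μ K_m / K_{m+1}` at every scale below the history horizon,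
# read off `HistP klPredsV17F2 … 0 n` (cell gate-hubbard-kl, seat p2 g24)

The (C) closer's one-calls (`twoLegRead_flow_registered_upto_u0f` / `_all_deep_u0f` / `_all_table_u0f`, p673285/p673916/p673919) take, for every scale `m` of the
private induction, the families `hP` (flow-piece jets), `hTJ` (reading jets), `hOK₁ : FrameOK R U m μ K_m`, `hOK₂ : FrameOK R U m μ K_{m+1}` (and at the last index
`hK`, `hK1`).  All four are projections of the public history: `RenormFlowAtV17F m = RenormalisedAtF ∧ FlowPieceJetsAt ∧ FlowGeometryAt`, `TwoLegStepV17F2 m`'s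
first conjunct is `TwoLegReadJetsF`, `frameOK_klFlowFrameU_succ` turns jets `≤ m` + geometry at `m` into `FrameOK R U m μ K_{m+1}`, and `K_0 = 0` is admissible on
`klWindowC` (`klFrameOK_zeroC`).  This file packages them (`…_of_hist`), so the closer feeds those four binders of the one-call with one term each.
Pure projections; no definitions; nothing asserts (C), any stub of 20437, K3 or superconductivity.  References: BGM 2006 §2.4 [cite: BenfattoGiulianiMastropietro2006].
-/

noncomputable section

namespace Summit.HubbardSuperconductivity.HubbardSuperconductivity.Theorems.KLRegimeSplit

set_option linter.dupNamespace false -- summit = problem name (single-conjunct summit), D-0017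

open Real Finset Literature.MathematicalPhysics.QuantumLattice Literature.Probability.LatticeModels
open Literature.MathematicalPhysics.QuantumLattice.FermiRG
open Summit.HubbardSuperconductivity.HubbardSuperconductivity.Theorems.KLProgrammeLegKernels

section Model

variable {L M : ℕ} [NeZero L] [NeZero M] {G : GeoConsts} {P : SplitConsts} {Q : EngConsts} {R : RenConsts} {β U μ : ℝ} {K : TrigPolyC4v} {n : ℕ}

/-- The renorm slot's (I-F) jets at every scale below the horizon. -/
theorem flowPieceJetsAt_of_hist (hhist : HistP klPredsV17F2 L M G P Q R β U μ K n) : ∀ m < n, FlowPieceJetsAt L M β U μ R m :=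
  fun m hm => (((histP_klPredsV17F2_iff L M G P Q R β U μ K n).1 hhist m hm).2.1).2.1

/-- The renorm slot's flow geometry at every scale below the horizon. -/
theorem flowGeometryAt_of_hist (hhist : HistP klPredsV17F2 L M G P Q R β U μ K n) : ∀ m < n, FlowGeometryAt L M β U μ m :=
  fun m hm => (((histP_klPredsV17F2_iff L M G P Q R β U μ K n).1 hhist m hm).2.1).2.2

/-- The two-leg slot's reading jets at every scale below the horizon. -/
theorem twoLegReadJetsF_of_hist (hhist : HistP klPredsV17F2 L M G P Q R β U μ K n) : ∀ m < n, TwoLegReadJetsF L M G Q β U μ m :=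
  fun m hm => (((histP_klPredsV17F2_iff L M G P Q R β U μ K n).1 hhist m hm).2.2.2).1

/-- The engine slot at every scale below the horizon. -/
theorem engineBoundsAtV17F2_of_hist (hhist : HistP klPredsV17F2 L M G P Q R β U μ K n) : ∀ m < n, EngineBoundsAtV17F2 L M G P Q β U μ m :=
  fun m hm => (((histP_klPredsV17F2_iff L M G P Q R β U μ K n).1 hhist m hm).2.2).1

/-- **`FrameOK R U m μ K_{m+1}` at every `m` below the horizon** (jets `≤ m` + geometry at `m`, `frameOK_klFlowFrameU_succ`). -/
theorem frameOK_klFlowFrameU_succ_of_hist (hhist : HistP klPredsV17F2 L M G P Q R β U μ K n) :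
    ∀ m < n, FrameOK R U m μ (klFlowFrameU L M β U μ (m + 1)) := fun m hm =>
  frameOK_klFlowFrameU_succ (fun j hj => flowPieceJetsAt_of_hist hhist j (lt_of_le_of_lt hj hm)) (flowGeometryAt_of_hist hhist m hm)

/-- **`FrameOK R U m μ K_m` at every `m ≤ n`** (`K_0 = 0` on `klWindowC`; `K_{j+1}` by the previous lemma at `j < n`, index raised by `FrameOK.mono`). -/
theorem frameOK_klFlowFrameU_self_of_hist (hhist : HistP klPredsV17F2 L M G P Q R β U μ K n) (hRW : R.WF) (hμ : μ ∈ klWindowC) :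
    ∀ m ≤ n, FrameOK R U m μ (klFlowFrameU L M β U μ m) := by
  intro m hm
  cases m with
  | zero => rw [klFlowFrameU_zero]; exact klFrameOK_zeroC hRW U 0 hμ
  | succ j => exact FrameOK.mono hRW.2.2 (Nat.le_succ j) (frameOK_klFlowFrameU_succ_of_hist hhist j (Nat.lt_of_succ_le hm))

/-- **The four history families of the (C) one-call, horizon `N + 1 ≤ n`**: flow-piece jets and reading jets at `m ≤ N`, `FrameOK R U m μ K_m` and
`FrameOK R U m μ K_{m+1}` at `m ≤ N`. -/
theorem oneCall_histFamilies_of_hist (hhist : HistP klPredsV17F2 L M G P Q R β U μ K n) (hRW : R.WF) (hμ : μ ∈ klWindowC) {N : ℕ} (hN : N + 1 ≤ n) :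
    (∀ m ≤ N, FlowPieceJetsAt L M β U μ R m) ∧ (∀ m ≤ N, TwoLegReadJetsF L M G Q β U μ m) ∧
      (∀ m ≤ N, FrameOK R U m μ (klFlowFrameU L M β U μ m)) ∧ (∀ m ≤ N, FrameOK R U m μ (klFlowFrameU L M β U μ (m + 1))) :=
  ⟨fun m hm => flowPieceJetsAt_of_hist hhist m (by omega), fun m hm => twoLegReadJetsF_of_hist hhist m (by omega),
    fun m hm => frameOK_klFlowFrameU_self_of_hist hhist hRW hμ m (by omega), fun m hm => frameOK_klFlowFrameU_succ_of_hist hhist m (by omega)⟩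

end Model

end Summit.HubbardSuperconductivity.HubbardSuperconductivity.Theorems.KLRegimeSplit

end
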